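import Summits.AtomisticToContinuum.Crystallization.Theses.GscTwinLoopSurgery
import Summits.AtomisticToContinuum.Crystallization.Theorems.GscTwinLoopSurgeryGscHingeGlueLimit
import Literature.MathematicalPhysics.StatisticalMechanics.HardCoreGSC

/-!
# Route `GscTwinLoopSurgery`, support item `GscHingeGlue` (stmt-AtomisticToContinuum-14087): the infinite-volume core

**Lemma A of the glue.** Assume `LocalLimitStable`, `LayeredWindows`, `TwinLoopLemma`,
`HcpPerfectWindows`, `LjRegistryDomination`. Then every `r₀`-relatively dense `X ∈ 𝔏` (local
limit of translated Lennard-Jones ground states) has, for every radius `R` and every tolerance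
`ε > 0`, a particle `p ∈ X` whose `R`-neighbourhood is two-way `ε`-matched with
`p + A (hcpStacking a h - q)` for some linear isometry `A`, some `(a, h) ∈ B′` and some base point
`q ∈ hcpStacking a h` (`exists_good_particle`).

Proof (Step 1 of the item's sketch, without the uniformity which the finite-`N` step does not
need): `LayeredWindows` gives `(1/1000)`-windows of every size; re-centred (inverse isometry,
nearest site, word shift) they are sets `Xₙ ∈ 𝔏` matched with `barlowStacking aₙ hₙ sₙ` on
`B(0, n)` (`exists_normalized_window`); a subsequence converges to `Y ∈ 𝔏` GLOBALLY matched with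
a limit stacking (`exists_limit_globally_matched`); `LjRegistryDomination` (`B′ ⊆ B`) and
`TwinLoopLemma` leave at most one wall, so the word alternates from some layer on; zooming away
from the wall (translates of `Y`, second extraction) gives `Z ∈ 𝔏` globally matched with
`hcpStacking a h`; `HcpPerfectWindows` gives an `ε/8`-perfect window in `Z`, which is re-based at
a particle and pulled back through the two local limits and the isometries to `X`
(`Matching` toolkit). All `[folklore]` glue; nothing here closes an item.
-/

noncomputable section

open scoped BigOperators Topology
open Filter Set Metric

namespace Summit.AtomisticToContinuum.Crystallization.Theorems.GscHingeGlue

open Literature.MathematicalPhysics.StatisticalMechanics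
open Summit.AtomisticToContinuum.Crystallization.Theses.GscTwinLoopSurgery

/-! ## Small tools -/

/-- `𝔏` is invariant under affine isometries `p ↦ L p + w`. [folklore] -/
theorem isLocalLimit_image_affine {X : Set (EuclideanSpace ℝ (Fin 3))}
    (hX : IsLocalLimitOfGroundStates lennardJones 3 X)
    (L : EuclideanSpace ℝ (Fin 3) →ₗᵢ[ℝ] EuclideanSpace ℝ (Fin 3)) (w : EuclideanSpace ℝ (Fin 3)) :
    IsLocalLimitOfGroundStates lennardJones 3 ((fun p => L p + w) '' X) := by
  have : (fun p => L p + w) '' X = (fun p => p + w) '' (L '' X) := by rw [image_image]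
  rw [this]
  exact (hX.image_linearIsometry L).image_add_const w

/-- A global two-way matching is a matching on every ball. [folklore] -/
theorem ballMatch_of_global {Y S : Set (EuclideanSpace ℝ (Fin 3))} {δ₀ : ℝ}
    (hg : (∀ p ∈ S, ∃ y ∈ Y, dist y p ≤ δ₀) ∧ (∀ y ∈ Y, ∃ p ∈ S, dist y p ≤ δ₀)) (R : ℝ)
    (c : EuclideanSpace ℝ (Fin 3)) : BallMatch δ₀ R c Y S :=
  ⟨fun p hp _ => hg.1 p hp, fun y hy _ => hg.2 y hy⟩

/-- Two eventual values of a sequence coincide. [folklore] -/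
theorem eq_of_eventually_eq {α : Type*} {f : ℕ → α} {a b : α} (h1 : ∀ᶠ n in atTop, f n = a)
    (h2 : ∀ᶠ n in atTop, f n = b) : a = b := by
  obtain ⟨n, hn1, hn2⟩ := (h1.and h2).exists
  rw [← hn1, hn2]

/-- `B′ ⊆ B`: the parameter box of the route lies in the box of `LjRegistryDomination`.
[folklore] -/
theorem box_sub_box {a h : ℝ}
    (hab : 191 / 200 ≤ a ∧ a ≤ 197 / 200 ∧ 81 / 100 * a ≤ h ∧ h ≤ 329 / 400 * a) :
    47 / 50 ≤ a ∧ a ≤ 1 ∧ 39 / 50 * a ≤ h ∧ h ≤ 17 / 20 * a := by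
  obtain ⟨h1, h2, h3, h4⟩ := hab
  refine ⟨by linarith, by linarith, by nlinarith, by nlinarith⟩

/-! ## Re-centred windows -/

/-- **Normalised windows.** Under `LocalLimitStable` and `LayeredWindows`, an `r₀`-dense
`X ∈ 𝔏` has, for every `n`, an affine isometric copy `Xₙ = L '' X + w` (again in `𝔏`) that is
two-way `(1/1000)`-matched with some `barlowStacking a h s`, `(a, h) ∈ B′`, `s` a `±1` word, on
the ball of radius `n` about the origin: take the window of radius `n + 3` given by
`LayeredWindows`, pull it back by the inverse isometry, and translate by the site nearest to the
window's centre (which shifts the word). [folklore] -/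
theorem exists_normalized_window (hLLS : LocalLimitStable) (hLW : LayeredWindows)
    {X : Set (EuclideanSpace ℝ (Fin 3))} (hX : IsLocalLimitOfGroundStates lennardJones 3 X)
    {r₀ : ℝ} (hr₀ : 0 < r₀) (hdense : ∀ c, ∃ q ∈ X, dist q c ≤ r₀) (n : ℕ) :
    ∃ (L : EuclideanSpace ℝ (Fin 3) ≃ₗᵢ[ℝ] EuclideanSpace ℝ (Fin 3)) (w : EuclideanSpace ℝ (Fin 3))
      (a h : ℝ) (s : ℤ → ℤ),
      (191 / 200 ≤ a ∧ a ≤ 197 / 200 ∧ 81 / 100 * a ≤ h ∧ h ≤ 329 / 400 * a) ∧ IsHaggSeq s ∧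
      BallMatch (1 / 1000) n 0 ((fun p => L p + w) '' X) (barlowStacking a h s) := by
  have hgsc : IsHardCoreGSC lennardJones X := hLLS X hX
  obtain ⟨c, -, A, v, a, h, s, hab, hs, hwin⟩ :=
    hLW X hX hgsc r₀ hr₀ hdense ((n : ℝ) + 3) (by positivity)
  have hwin' : BallMatch (1 / 1000) ((n : ℝ) + 3) c X
      ((fun p => A p + v) '' barlowStacking a h s) := hwin
  have ha : 0 < a := by linarith [hab.1]
  have hh : 0 < h := by nlinarith [hab.1, hab.2.2.1]
  -- pull back by the inverse isometry `A⁻¹ (· - v)`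
  have hgA : ∀ p, A.symm.toLinearIsometry (A p + v) + -(A.symm v) = p := fun p => by
    simp [map_add]
  have h1 := ballMatch_image_of_isometry
    (isometry_linearIsometry_add A.symm.toLinearIsometry (-(A.symm v))) hwin'
  have himg : (fun x => A.symm.toLinearIsometry x + -(A.symm v)) ''
      ((fun p => A p + v) '' barlowStacking a h s) = barlowStacking a h s := by
    rw [image_image]
    exact (image_congr (g := fun x => x) fun p _ => hgA p).trans (image_id' _)
  rw [himg] at h1
  -- translate by the site nearest to the new centre
  obtain ⟨K, i₀, j₀, hnear⟩ :=
    exists_barlowPos_near ha hh s (A.symm.toLinearIsometry c + -(A.symm v))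
  have h2 := ballMatch_image_of_isometry
    (isometry_linearIsometry_add (LinearIsometry.id (R := ℝ) (E := EuclideanSpace ℝ (Fin 3)))
      (-(barlowPos a h s K i₀ j₀))) h1
  have himg2 : (fun x => LinearIsometry.id (R := ℝ) (E := EuclideanSpace ℝ (Fin 3)) x +
      -(barlowPos a h s K i₀ j₀)) '' barlowStacking a h s = barlowStacking a h (fun m => s (m + K)) := by
    rw [← image_sub_barlowStacking a h s K i₀ j₀]
    exact image_congr fun p _ => by simp [sub_eq_add_neg]
  rw [himg2, image_image] at h2
  -- re-centre at the origin, radius `n`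
  have ha1 : a ≤ 1 := by linarith [hab.2.1]
  have hh1 : h ≤ 1 := by nlinarith [hab.2.1, hab.2.2.2]
  have h3 := ballMatch_recentre (c' := 0) (R' := (n : ℝ)) h2 (by
    have hd : dist (0 : EuclideanSpace ℝ (Fin 3))
        (LinearIsometry.id (R := ℝ) (E := EuclideanSpace ℝ (Fin 3))
          (A.symm.toLinearIsometry c + -(A.symm v)) + -(barlowPos a h s K i₀ j₀)) ≤ 3 := by
      rw [LinearIsometry.id_apply, dist_comm, ← sub_eq_add_neg, dist_eq_norm, sub_zero,
        ← dist_eq_norm]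
      linarith
    linarith)
  refine ⟨A.symm, -(A.symm v) + -(barlowPos a h s K i₀ j₀), a, h, fun m => s (m + K), hab,
    isHaggSeq_shift hs K, ?_⟩
  have hset : (fun x => LinearIsometry.id (R := ℝ) (E := EuclideanSpace ℝ (Fin 3))
      (A.symm.toLinearIsometry x + -(A.symm v)) + -(barlowPos a h s K i₀ j₀)) '' X =
      (fun p => A.symm p + (-(A.symm v) + -(barlowPos a h s K i₀ j₀))) '' X := by
    refine image_congr fun p _ => ?_
    simp only [LinearIsometry.id_apply, LinearIsometryEquiv.coe_toLinearIsometry]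
    abel
  rw [hset] at h3
  exact h3

/-! ## Re-basing a perfect window at a particle -/

/-- **From a window to a based window.** If `Z` and the translate `hcpStacking a h + v` are
two-way `ε₁`-matched on `B(c, R₁)` (`0 < a, h ≤ 1`, `ε₁ ≤ 1`, `R₁ ≥ 4`), then some particle
`z ∈ Z` carries a based window: `Z` and `z + (hcpStacking a h - q)` (`q` a site) are two-way
`2ε₁`-matched on `B(z, R₁ - 4)`. (Take the site `q` nearest to `c - v` and the particle `z`
matched to `q + v`.) [folklore] -/
theorem exists_based_of_window {Z : Set (EuclideanSpace ℝ (Fin 3))} {a h ε₁ R₁ : ℝ}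
    {c v : EuclideanSpace ℝ (Fin 3)} (ha : 0 < a) (hh : 0 < h) (ha1 : a ≤ 1) (hh1 : h ≤ 1)
    (hε₁1 : ε₁ ≤ 1) (hR₁ : 4 ≤ R₁)
    (hwin : BallMatch ε₁ R₁ c Z ((fun p => p + v) '' hcpStacking a h)) :
    ∃ z ∈ Z, ∃ q ∈ hcpStacking a h,
      BallMatch (2 * ε₁) (R₁ - 4) z Z
        ((fun s => z + (LinearIsometry.id (R := ℝ) (E := EuclideanSpace ℝ (Fin 3))) (s - q)) ''
          hcpStacking a h) := by
  obtain ⟨K, i, j, hnear⟩ := exists_barlowPos_near ha hh alternatingHagg (c - v)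
  set q := barlowPos a h alternatingHagg K i j with hq
  have hqmem : q ∈ hcpStacking a h := barlowPos_mem K i j
  have hqc : dist (q + v) c ≤ 2 := by
    have : dist (q + v) c = dist (c - v) q := by
      rw [dist_comm, dist_eq_norm, dist_eq_norm]
      congr 1
      abel
    rw [this]
    linarith
  obtain ⟨z, hz, hzq⟩ := hwin.1 (q + v) (mem_image_of_mem (fun p => p + v) hqmem) (by linarith)
  refine ⟨z, hz, q, hqmem, ?_, ?_⟩
  · rintro _ ⟨s, hs, rfl⟩ hsz
    simp only [LinearIsometry.id_apply] at hsz ⊢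
    have hsq : ‖s - q‖ ≤ R₁ - 4 := by
      rwa [dist_eq_norm, add_sub_cancel_left] at hsz
    have hsvc : dist (s + v) c ≤ R₁ :=
      calc dist (s + v) c ≤ dist (s + v) (q + v) + dist (q + v) c := dist_triangle _ _ _
        _ = ‖s - q‖ + dist (q + v) c := by rw [dist_add_right, dist_eq_norm]
        _ ≤ R₁ := by linarith
    obtain ⟨z', hz', hz's⟩ := hwin.1 (s + v) (mem_image_of_mem (fun p => p + v) hs) hsvc
    refine ⟨z', hz', ?_⟩
    have e : dist (s + v) (z + (s - q)) = dist z (q + v) := by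
      rw [dist_eq_norm, dist_eq_norm, ← norm_neg]
      congr 1
      abel
    calc dist z' (z + (s - q)) ≤ dist z' (s + v) + dist (s + v) (z + (s - q)) := dist_triangle _ _ _
      _ ≤ ε₁ + ε₁ := by rw [e]; exact add_le_add hz's hzq
      _ = 2 * ε₁ := by ring
  · intro z' hz' hz'z
    have hz'c : dist z' c ≤ R₁ :=
      calc dist z' c ≤ dist z' z + dist z (q + v) + dist (q + v) c := dist_triangle4 _ _ _ _
        _ ≤ (R₁ - 4) + ε₁ + 2 := by gcongr
        _ ≤ R₁ := by linarith
    obtain ⟨_, ⟨s, hs, rfl⟩, hz's⟩ := hwin.2 z' hz' hz'c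
    refine ⟨z + (LinearIsometry.id (R := ℝ) (E := EuclideanSpace ℝ (Fin 3))) (s - q),
      mem_image_of_mem _ hs, ?_⟩
    simp only [LinearIsometry.id_apply]
    have e : dist (s + v) (z + (s - q)) = dist z (q + v) := by
      rw [dist_eq_norm, dist_eq_norm, ← norm_neg]
      congr 1
      abel
    calc dist z' (z + (s - q)) ≤ dist z' (s + v) + dist (s + v) (z + (s - q)) := dist_triangle _ _ _
      _ ≤ ε₁ + ε₁ := by rw [e]; exact add_le_add hz's hzq
      _ = 2 * ε₁ := by ring

/-! ## Lemma A -/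

/-- **Lemma A (the infinite-volume core of `GscHingeGlue`).** Under `LocalLimitStable`,
`LayeredWindows`, `TwinLoopLemma`, `HcpPerfectWindows` and `LjRegistryDomination`, every
`r₀`-relatively dense `X ∈ 𝔏` has, for every `R ≥ 0` and every `0 < ε ≤ 1`, a particle `p ∈ X`,
parameters `(a, h) ∈ B′`, a linear isometry `A` and a site `q ∈ hcpStacking a h` such that `X`
and `p + A (hcpStacking a h - q)` are two-way `ε`-matched on `B(p, R)`. [folklore] -/
theorem exists_good_particle (hLLS : LocalLimitStable) (hLW : LayeredWindows)
    (hTLL : TwinLoopLemma) (hHPW : HcpPerfectWindows) (hLRD : LjRegistryDomination)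
    {X : Set (EuclideanSpace ℝ (Fin 3))} (hX : IsLocalLimitOfGroundStates lennardJones 3 X)
    {r₀ : ℝ} (hr₀ : 0 < r₀) (hdense : ∀ c, ∃ q ∈ X, dist q c ≤ r₀) {R ε : ℝ} (hR : 0 ≤ R)
    (hε : 0 < ε) (hε1 : ε ≤ 1) :
    ∃ p ∈ X, ∃ a h : ℝ, (191 / 200 ≤ a ∧ a ≤ 197 / 200 ∧ 81 / 100 * a ≤ h ∧ h ≤ 329 / 400 * a) ∧
      ∃ (A : EuclideanSpace ℝ (Fin 3) →ₗᵢ[ℝ] EuclideanSpace ℝ (Fin 3)) (q : EuclideanSpace ℝ (Fin 3)),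
        q ∈ hcpStacking a h ∧ BallMatch ε R p X ((fun s => p + A (s - q)) '' hcpStacking a h) := by
  classical
  -- (1) normalised windows of every size
  choose L w aseq hseq ss hbox hss hwin using exists_normalized_window hLLS hLW hX hr₀ hdense
  set Xs : ℕ → Set (EuclideanSpace ℝ (Fin 3)) := fun n => (fun p => L n p + w n) '' X with hXs
  have hXs𝔏 : ∀ n, IsLocalLimitOfGroundStates lennardJones 3 (Xs n) := fun n =>
    isLocalLimit_image_affine hX (L n).toLinearIsometry (w n)
  have hm : ∀ R' : ℝ, ∀ᶠ n in atTop,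
      BallMatch (1 / 1000) R' 0 (Xs n) (barlowStacking (aseq n) (hseq n) (ss n)) := by
    intro R'
    filter_upwards [eventually_ge_atTop ⌈R'⌉₊] with n hn
    exact (hwin n).mono le_rfl ((Nat.le_ceil R').trans (by exact_mod_cast hn))
  -- (2) a limit `Y ∈ 𝔏` globally matched with a limit stacking
  obtain ⟨φ, Y, a, h, s, hφ, hY, hlimY, hab, -, -, hs, -, hglob⟩ :=
    exists_limit_globally_matched (δ₀ := 1 / 1000) hXs𝔏 hbox hss hm
  have ha : 0 < a := by linarith [hab.1]
  have hh : 0 < h := by nlinarith [hab.1, hab.2.2.1]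
  have ha1 : a ≤ 1 := by linarith [hab.2.1]
  have hh1 : h ≤ 1 := by nlinarith [hab.2.1, hab.2.2.2]
  -- (3) at most one wall
  have hdom := hLRD a h (box_sub_box hab).1 (box_sub_box hab).2.1 (box_sub_box hab).2.2.1
    (box_sub_box hab).2.2.2
  have hwall : Set.Subsingleton {m : ℤ | s (m + 1) = s m} :=
    hTLL a h s Y hab hs hdom hY (hLLS Y hY) hglob
  obtain ⟨m₁, hm₁, halt⟩ := exists_tail_alternating hs hwall
  -- (4) zooming away from the wall
  set t : ℕ → EuclideanSpace ℝ (Fin 3) := fun n => barlowPos a h s (m₁ + 2 * n) 0 0 with ht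
  set Ys : ℕ → Set (EuclideanSpace ℝ (Fin 3)) := fun n => (fun p => p + -t n) '' Y with hYs
  have hYs𝔏 : ∀ n, IsLocalLimitOfGroundStates lennardJones 3 (Ys n) := fun n =>
    hY.image_add_const (-t n)
  have hYsmatch : ∀ R' : ℝ, ∀ᶠ n in atTop, BallMatch (1 / 1000) R' 0 (Ys n)
      (barlowStacking a h (fun m => s (m + (m₁ + 2 * n)))) := by
    intro R'
    refine Eventually.of_forall fun n => ?_
    have h1 := ballMatch_image_of_isometry
      (isometry_linearIsometry_add (LinearIsometry.id (R := ℝ) (E := EuclideanSpace ℝ (Fin 3)))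
        (-t n)) (ballMatch_of_global hglob R' (t n))
    have e1 : (fun x => LinearIsometry.id (R := ℝ) (E := EuclideanSpace ℝ (Fin 3)) x + -t n) ''
        barlowStacking a h s = barlowStacking a h (fun m => s (m + (m₁ + 2 * n))) := by
      rw [← image_sub_barlowStacking a h s (m₁ + 2 * n) 0 0]
      exact image_congr fun p _ => by simp [ht, sub_eq_add_neg]
    have e2 : (fun x => LinearIsometry.id (R := ℝ) (E := EuclideanSpace ℝ (Fin 3)) x + -t n) '' Y =
        Ys n := by
      show _ = (fun p => p + -t n) '' Y
      exact image_congr fun p _ => by simp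
    have e3 : LinearIsometry.id (R := ℝ) (E := EuclideanSpace ℝ (Fin 3)) (t n) + -t n = 0 := by
      simp
    rw [e1, e2, e3] at h1
    exact h1
  obtain ⟨ψ, Z, a', h', s', hψ, hZ, hlimZ, -, ha', hh', -, hss', hglobZ⟩ :=
    exists_limit_globally_matched (δ₀ := 1 / 1000) hYs𝔏
      (aseq := fun _ => a) (hseq := fun _ => h) (ss := fun n m => s (m + (m₁ + 2 * n)))
      (fun _ => hab) (fun n => isHaggSeq_shift hs _) hYsmatch
  -- the limit data are `(a, h, alternatingHagg)`
  have ea : a' = a := tendsto_nhds_unique ha' tendsto_const_nhds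
  have eh : h' = h := tendsto_nhds_unique hh' tendsto_const_nhds
  have es : s' = alternatingHagg := by
    funext m
    exact eq_of_eventually_eq (hss' m)
      (eventually_subseq hψ (eventually_shift_eq_alternatingHagg hm₁ halt m))
  rw [ea, eh, es] at hglobZ
  -- (5) a perfect window in `Z`, re-based at a particle
  have hglobZ' : (∀ p ∈ hcpStacking a h, ∃ q ∈ Z, dist q p ≤ 1 / 1000) ∧
      (∀ q ∈ Z, ∃ p ∈ hcpStacking a h, dist q p ≤ 1 / 1000) := hglobZ
  obtain ⟨c, v, hwinZ⟩ := hHPW a h Z hab hZ (hLLS Z hZ) hglobZ' (R + 16) (ε / 8) (by positivity)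
  have hwinZ' : BallMatch (ε / 8) (R + 16) c Z ((fun p => p + v) '' hcpStacking a h) := hwinZ
  obtain ⟨z, hz, q, hq, hWz⟩ := exists_based_of_window ha hh ha1 hh1
    (by linarith) (by linarith) hwinZ'
  -- (6) pull back to `Ys (ψ n)` for a large `n`
  have hWz' : BallMatch (ε / 4) ((R + 8) + 2 * (ε / 8)) z Z
      ((fun s => z + (LinearIsometry.id (R := ℝ) (E := EuclideanSpace ℝ (Fin 3))) (s - q)) ''
        hcpStacking a h) :=
    hWz.mono (by linarith) (by linarith)
  obtain ⟨n, hn⟩ := (hlimZ (dist z 0 + (R + 8) + ε / 4 + 3 * (ε / 8)) (ε / 8) (by positivity)).exists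
  obtain ⟨x₁, hx₁, -, hW₁⟩ := exists_ballMatch_based_of_near hz hWz' hn (by linarith)
    (by positivity) (by positivity) le_rfl
  -- (7) translate back to `Y`
  have hW₂ := ballMatch_based_image_affine
    (LinearIsometry.id (R := ℝ) (E := EuclideanSpace ℝ (Fin 3))) (t (ψ n)) hW₁
  have eY : (fun x => LinearIsometry.id (R := ℝ) (E := EuclideanSpace ℝ (Fin 3)) x + t (ψ n)) ''
      Ys (ψ n) = Y := by
    simp only [hYs, image_image, LinearIsometry.id_apply, neg_add_cancel_right, image_id']
  rw [eY] at hW₂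
  have hy : LinearIsometry.id (R := ℝ) (E := EuclideanSpace ℝ (Fin 3)) x₁ + t (ψ n) ∈ Y := by
    obtain ⟨y₀, hy₀, rfl⟩ := hx₁
    simpa using hy₀
  set y := LinearIsometry.id (R := ℝ) (E := EuclideanSpace ℝ (Fin 3)) x₁ + t (ψ n) with hydef
  set A₁ := (LinearIsometry.id (R := ℝ) (E := EuclideanSpace ℝ (Fin 3))).comp
    (LinearIsometry.id (R := ℝ) (E := EuclideanSpace ℝ (Fin 3))) with hA₁
  -- (8) pull back to `Xs (φ m)` for a large `m`
  have hW₂' : BallMatch (ε / 4 + 2 * (ε / 8)) ((R + 4) + 2 * (ε / 8)) y Y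
      ((fun s => y + A₁ (s - q)) '' hcpStacking a h) :=
    hW₂.mono le_rfl (by linarith)
  obtain ⟨m, hm'⟩ :=
    (hlimY (dist y 0 + (R + 4) + (ε / 4 + 2 * (ε / 8)) + 3 * (ε / 8)) (ε / 8) (by positivity)).exists
  obtain ⟨x₂, hx₂, -, hW₃⟩ := exists_ballMatch_based_of_near hy hW₂' hm' (by linarith)
    (by positivity) (by positivity) le_rfl
  -- (9) pull back to `X` by the inverse isometry
  obtain ⟨p, hp, rfl⟩ := hx₂
  have hW₄ := ballMatch_based_image_affine (L (φ m)).symm.toLinearIsometry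
    (-((L (φ m)).symm (w (φ m)))) hW₃
  have eX : (fun x => (L (φ m)).symm.toLinearIsometry x + -((L (φ m)).symm (w (φ m)))) ''
      Xs (φ m) = X := by
    show _ '' ((fun p => L (φ m) p + w (φ m)) '' X) = X
    rw [image_image]
    exact (image_congr (g := fun x => x) fun p _ => by simp [map_add]).trans (image_id' X)
  have ep : (L (φ m)).symm.toLinearIsometry (L (φ m) p + w (φ m)) + -((L (φ m)).symm (w (φ m))) =
      p := by simp [map_add]
  rw [eX, ep] at hW₄
  exact ⟨p, hp, a, h, hab, _, q, hq, hW₄.mono (by linarith) (by linarith)⟩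

end Summit.AtomisticToContinuum.Crystallization.Theorems.GscHingeGlue

end
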